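import Literature.AlgebraicGeometry.Resolution.HasseSchmidtDiffEqDiffOp
import HarnessLib

/-!
# [OURS · L1 W3.1] Hasse–Schmidt-type families on a `K`-algebra EXTENDING the Hasse derivatives of `K[X]` along a
# coordinate map: order, `𝔪`-adic order lowering, and the SYMBOL CONGRUENCE — the bridge-free algebra of the graded
# transfer «`℘(E)_ξ` Diff-closed (U19_3) ⇒ edge algebra Hasse-stable (U19_4_R2)»

Cell `res-hironaka` (run/shared/lean/pub/res-hironaka/), rung L (rescue) of LADDER-RESOLUTION, slot W3.1 «u.s.c. first»,
seat res-L1-s31-pv-1. Host (custody, no new route) = the EXISTING crux `Theses.MarkedTransfer.HypersurfaceOrderReduction`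
(stmt-ResolutionOfSingularities-16155, `--supports … --as helper`), as every W3.1 file.

WHY. After `CampaignW31EdgeHilbLsc_holds` (p474858) and the finite-degree assembly (p475766) the whole u.s.c. rung of slot
W3.1 hinges on the dictionary (ii), whose one manuscript-side premise is the Hasse-stability of the pulled-back edge algebra
(typed candidate `S04CharAlgebra.U19_4_R2`, reading R2 of p.19 l.31–32 «so that `G` must be Diff-closed»). The route of record
(cell STATUS, res-L1-s31-pv-1 ROUTE-NOTE 2026-08-27) derives it from the stalk-level Diff-closedness of `℘(E)_ξ` (typed
`U19_3`, landed modulo Th. 4.1 by the discharge lane, p475850) through a family of `K`-linear operators `Δ_β` on `O_ξ`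
obtained by lifting the Taylor morphism of `K[X_1, …, X_n]` along the coordinate map `φ : K[X] → O_ξ`, `X_i ↦ z_i` (a regular
system of parameters). This file is the PURE-ALGEBRA part of that route, with the family `Δ` taken as data subject to three
hypotheses — `Δ_0 = id`, the Leibniz rule `Δ_β(xy) = Σ_{β′+β″=β} Δ_{β′}(x) Δ_{β″}(y)`, and the extension property
`Δ_β(φ F) = φ(D^{(β)} F)` (tree `Resolution.hasseDeriv`) — and NO geometry: it applies verbatim to any commutative
`K`-algebra `O`, any `K`-algebra map `φ : K[X_σ] → O` and any ideal `P` containing the `φ(X_i)`.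

HONEST FRAMING. Everything below is elementary commutative algebra over Mathlib and the tree's Hasse–Schmidt calculus
(`Literature/AlgebraicGeometry/Resolution/HasseSchmidtDerivatives.lean`, `…/HasseSchmidtDiffEqDiffOp.lean`,
`…/DifferentialOperators.lean`); NOTHING here is a statement of H. Hironaka's manuscript *Resolution of singularities in
positive characteristics* (2017-03-23, [Hironaka2017], lit key `paper:url-3343fd9e678b`), no candidate statement of it is used,
and nothing is asserted about it. AI-produced kernel bookkeeping, weaker than expert review.

## What is proved (namespace `…Theorems.CampaignW31`; `K`, `O` commutative, `O` a `K`-algebra, `σ` any index type)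

For `Δ : (σ →₀ ℕ) → (O →ₗ[K] O)` with `Δ 0 = id` and the Leibniz rule:
* `leibnizFamily_commMul` — `[Δ_β, a] = Σ_{β′+β″=β, β′≠0} Δ_{β′}(a) • Δ_{β″}` (the commutator with a multiplication is a
  combination of members of STRICTLY smaller degree; pattern of the tree's `commMul_hasseDeriv`);
* `leibnizFamily_isDiffOpLE` — each `Δ_β` is a differential operator of order `≤ |β|` over `K` (tree `IsDiffOpLE`,
  EGA IV₄ 16.8.8 (b)); `leibnizFamily_mem_diffOp`;
* `leibnizFamily_apply_mem_pow_sub` — `Δ_β(P^j) ⊆ P^{j−|β|}` for EVERY ideal `P` (tree `IsDiffOpLE.apply_mem_pow_sub`).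
If moreover `Δ` extends the Hasse derivatives along `φ : K[X_σ] →ₐ[K] O` and `φ(X_i) ∈ P` for all `i`:
* `aeval_monomial_mem_pow_degree` — `φ(c X^γ) ∈ P^{|γ|}`;
* `leibnizFamily_apply_mul_aeval_monomial_sub_mem` — for `|γ| = d` and `|β| ≤ d`:
  `Δ_β(c · φ(X^γ)) − c · φ(D^{(β)} X^γ) ∈ P^{d+1−|β|}` for every `c ∈ O` (the cross terms `Δ_{β′}(c) φ(D^{(β″)}X^γ)`,
  `β′ ≠ 0`, have `|β″| < |β|`);
* `leibnizFamily_symbol_congr` — THE SYMBOL CONGRUENCE: for `g = Σ_{γ ∈ S} c_γ φ(X^γ) + h` with all `|γ| = d`,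
  `h ∈ P^{d+1}` and `|β| ≤ d`: `Δ_β g ≡ Σ_{γ ∈ S} c_γ φ(D^{(β)} X^γ) (mod P^{d+1−|β|})` — i.e. on `P^d / P^{d+1}` the
  operator `Δ_β` acts as the Hasse derivative `D^{(β)}` on initial forms (with `D^{(β)} X^γ = C(γ, β) X^{γ−β}`, tree
  `hasseDeriv_monomial`).

Consumers: with `O = O_{Z,ξ}`, `P = 𝔪_ξ`, `φ(X_i) = z_i` a regular system of parameters and `Δ` the coefficients of a lift of
the Taylor morphism (to be constructed from the formal étaleness of `φ` at a closed point — NOT done here), the last item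
says `ν((Δ_β g) X^{d−|β|}) = polyMap(D^{(β)} F)` for `polyMap F = ν(g X^d)`; with `U19_3` this is `U19_4_R2`.

## References (context only; nothing below is a premise)
* A. Grothendieck, J. Dieudonné, EGA IV₄ (1967), Prop. 16.8.8, Thm. 16.11.2 (Hasse–Schmidt basis of `Diff` on affine
  space; tree files cited above). [EGAIV4]
* H. Hironaka, ms. 2017-03-23, §4.1 (8) p.19 l.27–32 — scope only, under adjudication. [Hironaka2017]
-/

set_option linter.dupNamespace false -- mandated namespace of this single-conjunct summit

open MvPolynomial

namespace Summit.ResolutionOfSingularities.ResolutionOfSingularities.Theorems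

open Literature.AlgebraicGeometry.Resolution

universe u v w

namespace CampaignW31

section LeibnizFamily

variable {K : Type u} [CommRing K] {O : Type v} [CommRing O] [Algebra K O] {σ : Type w} [DecidableEq σ]
variable (Δ : (σ →₀ ℕ) → (O →ₗ[K] O))

/-- **Commutator of a Leibniz family member with a multiplication**: if `Δ_0 = id` and
`Δ_β(xy) = Σ_{β′+β″=β} Δ_{β′}(x) Δ_{β″}(y)`, then `[Δ_β, a] = Σ_{(β′,β″) ≠ (0,β)} Δ_{β′}(a) • Δ_{β″}` (Leibniz minus its
`β′ = 0` term; pattern of the tree's `commMul_hasseDeriv`). [folklore] -/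
theorem leibnizFamily_commMul (h0 : Δ 0 = LinearMap.id)
    (hmul : ∀ (β : σ →₀ ℕ) (x y : O), Δ β (x * y) = ∑ p ∈ Finset.antidiagonal β, Δ p.1 x * Δ p.2 y)
    (β : σ →₀ ℕ) (a : O) :
    commMul K (Δ β) a = ∑ p ∈ (Finset.antidiagonal β).erase (0, β), Δ p.1 a • Δ p.2 := by
  refine LinearMap.ext fun t => ?_
  have hmem : ((0 : σ →₀ ℕ), β) ∈ Finset.antidiagonal β := by simp
  rw [commMul_apply, hmul, ← Finset.add_sum_erase _ _ hmem, LinearMap.sum_apply]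
  simp only [h0, LinearMap.id_apply, LinearMap.smul_apply, smul_eq_mul]
  ring

/-- **Each member of a Leibniz family is a differential operator of order `≤ |β|`** over `K` (tree `IsDiffOpLE`,
EGA IV₄ 16.8.8 (b)): induction on `|β|` through `leibnizFamily_commMul`, the punctured antidiagonal having second
components of smaller degree (tree `degree_snd_lt_of_mem_erase_antidiagonal`). [folklore] -/
theorem leibnizFamily_isDiffOpLE (h0 : Δ 0 = LinearMap.id)
    (hmul : ∀ (β : σ →₀ ℕ) (x y : O), Δ β (x * y) = ∑ p ∈ Finset.antidiagonal β, Δ p.1 x * Δ p.2 y) :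
    ∀ (m : ℕ) (β : σ →₀ ℕ), β.degree ≤ m → IsDiffOpLE K m (Δ β)
  | 0, β, hβ => by
    have : β = 0 := (Finsupp.degree_eq_zero_iff β).1 (Nat.le_zero.1 hβ)
    subst this
    rw [h0]
    exact isDiffOpLE_id
  | m + 1, β, hβ => fun a => by
    rw [leibnizFamily_commMul Δ h0 hmul]
    refine IsDiffOpLE.sum _ fun p hp => IsDiffOpLE.smul _ (leibnizFamily_isDiffOpLE h0 hmul m p.2 ?_)
    have := degree_snd_lt_of_mem_erase_antidiagonal hp
    omega

/-- `Δ_β ∈ Diff^{≤ |β|}_{O/K}` (tree `diffOp`). [folklore] -/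
theorem leibnizFamily_mem_diffOp (h0 : Δ 0 = LinearMap.id)
    (hmul : ∀ (β : σ →₀ ℕ) (x y : O), Δ β (x * y) = ∑ p ∈ Finset.antidiagonal β, Δ p.1 x * Δ p.2 y)
    (β : σ →₀ ℕ) : Δ β ∈ diffOp K O β.degree :=
  leibnizFamily_isDiffOpLE Δ h0 hmul _ β le_rfl

/-- **`𝔪`-adic order lowering**: `Δ_β(P^j) ⊆ P^{j − |β|}` for EVERY ideal `P` of `O` (a differential operator of order
`≤ |β|` lowers `P`-adic orders by at most `|β|`, tree `IsDiffOpLE.apply_mem_pow_sub`). [folklore] -/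
theorem leibnizFamily_apply_mem_pow_sub (h0 : Δ 0 = LinearMap.id)
    (hmul : ∀ (β : σ →₀ ℕ) (x y : O), Δ β (x * y) = ∑ p ∈ Finset.antidiagonal β, Δ p.1 x * Δ p.2 y)
    (P : Ideal O) (j : ℕ) (β : σ →₀ ℕ) {x : O} (hx : x ∈ P ^ j) : Δ β x ∈ P ^ (j - β.degree) :=
  IsDiffOpLE.apply_mem_pow_sub P j (leibnizFamily_isDiffOpLE Δ h0 hmul _ β le_rfl) hx

end LeibnizFamily

/-! ## Extension of the Hasse derivatives along a coordinate map `φ : K[X_σ] → O` -/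

section Extension

variable {K : Type u} [CommRing K] {O : Type v} [CommRing O] [Algebra K O] {σ : Type w} [DecidableEq σ]

omit [DecidableEq σ] in
/-- Degrees and truncated subtraction: `|γ| − |δ| ≤ |γ − δ|`. [folklore] -/
theorem degree_sub_degree_le_degree_tsub (γ δ : σ →₀ ℕ) : γ.degree - δ.degree ≤ (γ - δ).degree := by
  have h : γ.degree ≤ (γ - δ).degree + δ.degree := by
    rw [← map_add]
    exact Finsupp.degree_mono le_tsub_add
  omega

omit [DecidableEq σ] in
/-- `φ(c X^γ) ∈ P^{|γ|}` as soon as `φ(X_i) ∈ P` for all `i`. [folklore] -/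
theorem aeval_monomial_mem_pow_degree (φ : MvPolynomial σ K →ₐ[K] O) (P : Ideal O) (hz : ∀ i, φ (X i) ∈ P)
    (γ : σ →₀ ℕ) (c : K) : φ (monomial γ c) ∈ P ^ γ.degree := by
  induction γ using Finsupp.induction generalizing c with
  | zero =>
    simp only [map_zero, pow_zero, Ideal.one_eq_top]
    exact Submodule.mem_top
  | single_add i k γ _ _ ih =>
    have hsplit : monomial (Finsupp.single i k + γ) c = X i ^ k * monomial γ c := by
      rw [X_pow_eq_monomial, monomial_mul, one_mul]
    rw [hsplit, map_mul, map_pow, map_add, Finsupp.degree_single, pow_add]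
    exact Ideal.mul_mem_mul (Ideal.pow_mem_pow (hz i) k) (ih c)

variable (Δ : (σ →₀ ℕ) → (O →ₗ[K] O)) (φ : MvPolynomial σ K →ₐ[K] O) (P : Ideal O)

/-- **One monomial**: if `Δ` is a Leibniz family with `Δ_0 = id` EXTENDING the Hasse derivatives along `φ`
(`Δ_β(φ F) = φ(D^{(β)} F)`) and `φ(X_i) ∈ P`, then for `|γ| = d`, `|β| ≤ d` and every `c ∈ O`:
`Δ_β(c · φ(X^γ)) − c · φ(D^{(β)} X^γ) ∈ P^{d+1−|β|}` — the cross terms `Δ_{β′}(c) · φ(D^{(β″)} X^γ)` with `β′ ≠ 0` have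
`|β″| ≤ |β| − 1`, and `φ(D^{(β″)} X^γ) = C(γ,β″) φ(X^{γ−β″}) ∈ P^{|γ|−|β″|}` (tree `hasseDeriv_monomial`). [folklore] -/
theorem leibnizFamily_apply_mul_aeval_monomial_sub_mem (h0 : Δ 0 = LinearMap.id)
    (hmul : ∀ (β : σ →₀ ℕ) (x y : O), Δ β (x * y) = ∑ p ∈ Finset.antidiagonal β, Δ p.1 x * Δ p.2 y)
    (hext : ∀ (β : σ →₀ ℕ) (F : MvPolynomial σ K), Δ β (φ F) = φ (hasseDeriv K β F))
    (hz : ∀ i, φ (X i) ∈ P) {d : ℕ} {γ β : σ →₀ ℕ} (hγ : γ.degree = d) (hβ : β.degree ≤ d) (c : O) :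
    Δ β (c * φ (monomial γ 1)) - c * φ (hasseDeriv K β (monomial γ 1)) ∈ P ^ (d + 1 - β.degree) := by
  have hmem : ((0 : σ →₀ ℕ), β) ∈ Finset.antidiagonal β := by simp
  rw [hmul, ← Finset.add_sum_erase _ _ hmem]
  simp only [h0, LinearMap.id_apply, hext]
  rw [add_sub_cancel_left]
  refine Ideal.sum_mem _ fun p hp => ?_
  have hlt : p.2.degree < β.degree := degree_snd_lt_of_mem_erase_antidiagonal hp
  -- `φ(D^{(p.2)} X^γ) = C(γ, p.2) · φ(X^{γ - p.2}) ∈ P^{|γ - p.2|}`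
  have hD : φ (hasseDeriv K p.2 (monomial γ 1)) ∈ P ^ (γ - p.2).degree := by
    rw [hasseDeriv_monomial, map_mul]
    exact Ideal.mul_mem_left _ _ (aeval_monomial_mem_pow_degree φ P hz (γ - p.2) 1)
  have hle : d + 1 - β.degree ≤ (γ - p.2).degree := by
    have := degree_sub_degree_le_degree_tsub γ p.2
    omega
  exact Ideal.mul_mem_left _ _ (Ideal.pow_le_pow_right hle hD)

/-- **THE SYMBOL CONGRUENCE.** Let `Δ` be a Leibniz family with `Δ_0 = id` extending the Hasse derivatives along
`φ : K[X_σ] → O`, and `P` an ideal containing all `φ(X_i)`. If `g = Σ_{γ ∈ S} c_γ · φ(X^γ) + h` with `|γ| = d` on `S`,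
`h ∈ P^{d+1}` and `|β| ≤ d`, then `Δ_β g − Σ_{γ ∈ S} c_γ · φ(D^{(β)} X^γ) ∈ P^{d+1−|β|}`: modulo `P^{d+1−|β|}` the operator
`Δ_β` acts on `P^d` as the Hasse derivative `D^{(β)}` on initial forms (the remainder `h` drops by
`leibnizFamily_apply_mem_pow_sub`, each monomial term by `leibnizFamily_apply_mul_aeval_monomial_sub_mem`). [folklore] -/
theorem leibnizFamily_symbol_congr (h0 : Δ 0 = LinearMap.id)
    (hmul : ∀ (β : σ →₀ ℕ) (x y : O), Δ β (x * y) = ∑ p ∈ Finset.antidiagonal β, Δ p.1 x * Δ p.2 y)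
    (hext : ∀ (β : σ →₀ ℕ) (F : MvPolynomial σ K), Δ β (φ F) = φ (hasseDeriv K β F))
    (hz : ∀ i, φ (X i) ∈ P) {d : ℕ} (S : Finset (σ →₀ ℕ)) (hS : ∀ γ ∈ S, γ.degree = d) (c : (σ →₀ ℕ) → O)
    {h : O} (hh : h ∈ P ^ (d + 1)) {β : σ →₀ ℕ} (hβ : β.degree ≤ d) :
    Δ β ((∑ γ ∈ S, c γ * φ (monomial γ 1)) + h) - ∑ γ ∈ S, c γ * φ (hasseDeriv K β (monomial γ 1)) ∈
      P ^ (d + 1 - β.degree) := by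
  have hΔh : Δ β h ∈ P ^ (d + 1 - β.degree) := leibnizFamily_apply_mem_pow_sub Δ h0 hmul P (d + 1) β hh
  have hsum : Δ β (∑ γ ∈ S, c γ * φ (monomial γ 1)) - ∑ γ ∈ S, c γ * φ (hasseDeriv K β (monomial γ 1)) ∈
      P ^ (d + 1 - β.degree) := by
    rw [map_sum, ← Finset.sum_sub_distrib]
    exact Ideal.sum_mem _ fun γ hγ =>
      leibnizFamily_apply_mul_aeval_monomial_sub_mem Δ φ P h0 hmul hext hz (hS γ hγ) hβ (c γ)
  have e : Δ β ((∑ γ ∈ S, c γ * φ (monomial γ 1)) + h) - ∑ γ ∈ S, c γ * φ (hasseDeriv K β (monomial γ 1)) =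
      (Δ β (∑ γ ∈ S, c γ * φ (monomial γ 1)) - ∑ γ ∈ S, c γ * φ (hasseDeriv K β (monomial γ 1))) + Δ β h := by
    rw [map_add]; ring
  rw [e]
  exact Ideal.add_mem _ hsum hΔh

/-- **Every element of `P^d` has the shape used above** when `P` is GENERATED by the `φ(X_i)` and `σ` is finite: for
`g ∈ P^d` there are a finite set `S` of exponents of degree `d` and coefficients `c_γ ∈ O` with `g = Σ_{γ ∈ S} c_γ φ(X^γ)`
(`P^d` is spanned by the degree-`d` monomials in the generators). [folklore] -/
theorem exists_sum_eq_of_mem_span_pow [Fintype σ] (hP : P = Ideal.span (Set.range fun i => φ (X i))) {d : ℕ} {g : O}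
    (hg : g ∈ P ^ d) :
    ∃ (S : Finset (σ →₀ ℕ)) (c : (σ →₀ ℕ) → O), (∀ γ ∈ S, γ.degree = d) ∧ g = ∑ γ ∈ S, c γ * φ (monomial γ 1) := by
  classical
  -- `P^d ⊆ span {φ(X^γ) : |γ| = d}`
  have hle : ∀ d : ℕ, P ^ d ≤ Ideal.span ((fun γ : σ →₀ ℕ => φ (monomial γ 1)) '' {γ | γ.degree = d}) := by
    intro d
    induction d with
    | zero =>
      rw [pow_zero, Ideal.one_eq_top, top_le_iff, Ideal.eq_top_iff_one]
      refine Ideal.subset_span ⟨0, by simp, by simp⟩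
    | succ d ih =>
      rw [pow_succ, hP]
      refine (Ideal.mul_mono_left (hP ▸ ih)).trans ?_
      rw [Ideal.span_mul_span']
      refine Ideal.span_le.2 ?_
      rintro _ ⟨a, ⟨γ, hγ, rfl⟩, b, ⟨i, rfl⟩, rfl⟩
      refine Ideal.subset_span ⟨γ + Finsupp.single i 1, ?_, ?_⟩
      · simp only [Set.mem_setOf_eq] at hγ ⊢
        rw [map_add, Finsupp.degree_single, hγ]
      · show φ (monomial (γ + Finsupp.single i 1) 1) = φ (monomial γ 1) * φ (X i)
        rw [← map_mul, X, monomial_mul, mul_one]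
  have hg' := hle d hg
  rw [Ideal.span, Submodule.mem_span_image_iff_exists_fun] at hg'
  obtain ⟨T, hT, f, hf⟩ := hg'
  refine ⟨T, fun γ => if h : γ ∈ T then f ⟨γ, h⟩ else 0, fun γ hγ => hT hγ, ?_⟩
  rw [← hf, ← Finset.sum_attach T]
  refine Finset.sum_congr rfl fun γ _ => ?_
  simp only [γ.2, dif_pos, smul_eq_mul]

end Extension

end CampaignW31

end Summit.ResolutionOfSingularities.ResolutionOfSingularities.Theorems
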